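import Summits.QuantumFields.YangMills.Theses.ColdStartUniversality
import Summits.QuantumFields.YangMills.Theorems.ColdStartUniversalityColdStartContinuumCauchyCesaroLawUnique
import Summits.QuantumFields.YangMills.Theorems.TransportPerturbationLoopStringLipschitz

/-!
# Route `ColdStartUniversality`, crux K_A2 `ColdStartContinuumCauchy` (stmt-QuantumFields-24810), LINE 3 «lindeberg_swap»:
# the two FREE registered stubs `stub_cesaroLawUnique` and `stub_loopStringLipschitz` BY NAME AND SIGNATURE

Planner-of-record candidate file (ideator seat ym-idea-5 g15, HOME/stubplan-g15/LindebergSwapFreeStubs.lean; verified rc 0 by critic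
idea-crit-5 NOTE #165), landed `--supports stmt-QuantumFields-24810` by width seat ym-line-sfw-p2-w3 g29 (free hands).  It reproduces the registered skeleton's abbreviations VERBATIM (skeleton sha
5aa38edd5509, `Lines_lindeberg_swap.lean` ll. 13–262: `G2`, `su2Rep`, `avSU`, `toField`, `obsK`, `cesaro`, `IsColdStartSol`,
`IsSolFamily`, `avgField`, `fieldDistAt`, `discG`, `wdisc`, `InCls`, the node Props and the `__Registered.*` aliases) and closes
* `stub_cesaroLawUnique`   := `Theorems.ColdStartUniversality.cesaroLawUnique` (p625805, seat ym-line-csu-p1 g3), and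
* `stub_loopStringLipschitz` := `Theorems.TransportPerturbation.loopStringLipschitz_proof` (item 26919 CLOSED, seat ym-line-sfw-p1 g12),
both by definitional unfolding only.  HONEST FRAMING: the load-bearing stubs `stub_oneWindowSwap` (XL), `stub_scalePropagation`
(XL), `stub_stepDownCompat` (M), `stub_lindebergTelescoping` (L) and the rung `stub_shortWindowSwap` are NOT proved here; no crux,
route, rung or mass gap is proved.
-/

namespace Summit.QuantumFields.YangMills.Cruxes.ColdStartContinuumCauchy.LindebergSwap

open scoped BigOperators Topology Classical MeasureTheory ProbabilityTheory NNReal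
open Filter Set Function MeasureTheory
open Literature.MathematicalPhysics.QuantumFieldTheory
open Literature.MathematicalPhysics.QuantumFieldTheory.Balaban1983to89
open Literature.MathematicalPhysics.QuantumLattice

/-- The gauge group `SU(2)` as `2 × 2` complex matrices. -/
abbrev G2 : Type := Matrix.specialUnitaryGroup (Fin 2) ℂ

/-- The SZZ lattice representation datum of `SU(2)` (verbatim from the crux). -/
noncomputable abbrev su2Rep : LatticeRep G2 :=
  ⟨2, fundamentalRep (Fin 2), continuous_fundamentalRep _, fundamentalRep_injective _, fundamentalRep_mem_unitaryGroup⟩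

/-- Bałaban's small-loop average used by the leaf. -/
noncomputable abbrev avSU : LoopAverage G2 := ExpMeanLog.expMeanLogSU

variable (F : T3ContinuumYM3Torus.T3Family)

/-- A step-`K` link configuration read as a level-0 gauge field of Bałaban's `K`-th lattice. -/
def toField (K : ℕ) (c : GaugeConfig 3 ((F.P K).sitesPerDir 0) G2) : GaugeField (F.P K) 0 G2 :=
  fun b : PBond (F.P K) 0 => c (b.src, b.dir)

/-- The crux's integrand at step `K` (verbatim shape of line `blocknoise_coupling`, so that the shared node matches). -/
noncomputable def obsK (K : ℕ) (os : List (T3ContinuumYM3Torus.ULoop3 F))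
    (c : GaugeConfig 3 ((F.P K).sitesPerDir 0) G2) : ℝ :=
  (os.map fun C => F.avgObs avSU K C (fun b : PBond (F.P K) 0 => c (b.src, b.dir))).prod

/-- The crux's physical-time Cesàro mean over `[0, T]` (verbatim from line `blocknoise_coupling`). -/
noncomputable def cesaro (K : ℕ) (os : List (T3ContinuumYM3Torus.ULoop3 F)) (T : ℝ)
    {Ω : Type} [MeasurableSpace Ω] (P : Measure Ω)
    (U : ℝ≥0 → Ω → GaugeConfig 3 ((F.P K).sitesPerDir 0) G2) : ℝ :=
  T⁻¹ * intervalIntegral (fun s : ℝ => MeasureTheory.integral P (fun ω => obsK F K os (U (s / (F.P K).eps).toNNReal ω)))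
    0 T MeasureTheory.volume

/-- «cold-start strong solution at step `K`» (verbatim from the crux). -/
def IsColdStartSol (γ : ℝ) (K : ℕ) {Ω : Type} [MeasurableSpace Ω] (P : Measure Ω)
    (W : ℝ≥0 → Ω → (Edge 3 ((F.P K).sitesPerDir 0) × NoiseIdx 2 → ℝ)) (hW : IsFlatBrownian W P)
    (U : ℝ≥0 → Ω → GaugeConfig 3 ((F.P K).sitesPerDir 0) G2) : Prop :=
  (∀ ω, U 0 ω = fun _ => 1) ∧
    (latticeLangevinDynamics su2Rep ((γ * (F.P K).eps)⁻¹ / 2)).IsSolution (fundamentalRep (Fin 2))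
      hW.natFiltration P W U

/-- «`V` is a JOINTLY MEASURABLE family of strong solutions of the step-`K` SZZ dynamics from EVERY deterministic start,
driven by one flat Brownian motion» (the coarse Markov family of the Lindeberg scheme). -/
def IsSolFamily (γ : ℝ) (K : ℕ) {Ω : Type} [MeasurableSpace Ω] (P : Measure Ω)
    (W : ℝ≥0 → Ω → (Edge 3 ((F.P K).sitesPerDir 0) × NoiseIdx 2 → ℝ)) (hW : IsFlatBrownian W P)
    (V : GaugeConfig 3 ((F.P K).sitesPerDir 0) G2 → ℝ≥0 → Ω → GaugeConfig 3 ((F.P K).sitesPerDir 0) G2) : Prop :=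
  (∀ x, (∀ ω, V x 0 ω = x) ∧
    (latticeLangevinDynamics su2Rep ((γ * (F.P K).eps)⁻¹ / 2)).IsSolution (fundamentalRep (Fin 2))
      hW.natFiltration P W (V x)) ∧
  ∀ t : ℝ≥0, Measurable (fun p : GaugeConfig 3 ((F.P K).sitesPerDir 0) G2 × Ω => V p.1 t p.2)

/-! ## Multi-depth block averages and the SCALE-WEIGHTED discrepancy -/

/-- The `j`-fold block-averaged field (depth `j`, physical scale `L^{-(K-j)}`) of a step-`K` configuration. -/
noncomputable def avgField (K j : ℕ) (c : GaugeConfig 3 ((F.P K).sitesPerDir 0) G2) : GaugeField (F.P K) j G2 :=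
  Averaging.iter (fun i => BlockAveraging.blockAvg (P := F.P K) (j := i) avSU) j (toField F K c)

/-- Sup-entry distance of two depth-`j` gauge fields. -/
noncomputable def fieldDistAt (K j : ℕ) (V V' : GaugeField (F.P K) j G2) : ℝ :=
  ⨆ p : PBond (F.P K) j × Fin 2 × Fin 2,
    ‖(V p.1 : Matrix (Fin 2) (Fin 2) ℂ) p.2.1 p.2.2 - (V' p.1 : Matrix (Fin 2) (Fin 2) ℂ) p.2.1 p.2.2‖

/-- Depth-`j` discrepancy MODULO THE DEPTH-`j` GAUGE GROUP. -/
noncomputable def discG (K j : ℕ) (u v : GaugeConfig 3 ((F.P K).sitesPerDir 0) G2) : ℝ :=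
  ⨅ h : GaugeTransf (F.P K) j G2, fieldDistAt F K j (avgField F K j u) (GaugeField.gaugeAct h (avgField F K j v))

/-- SCALE-WEIGHTED DISCREPANCY: `Σ_{j ≤ K} L^{-(K-j)} · discG_j` — depth-`j` content weighted by its physical scale (the
unit depth `j = K` has weight `1`, the cut-off depth `j = 0` has weight `ε_K`). -/
noncomputable def wdisc (K : ℕ) (u v : GaugeConfig 3 ((F.P K).sitesPerDir 0) G2) : ℝ :=
  ∑ j ∈ Finset.range (K + 1), ((F.L : ℝ)⁻¹) ^ (K - j) * discG F K j u v

/-- The SCALE-WEIGHTED LIPSCHITZ CLASS `𝒢_K(A)`: measurable, bounded by `1`, `A`-Lipschitz for `wdisc`. -/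
def InCls (K : ℕ) (A : ℝ) (g : GaugeConfig 3 ((F.P K).sitesPerDir 0) G2 → ℝ) : Prop :=
  Measurable g ∧ (∀ u, |g u| ≤ 1) ∧ ∀ u v, |g u - g v| ≤ A * wdisc F K u v

/-! ## One Bałaban averaging step between consecutive cut-offs -/

/-- Level `1` of the `(K+1)`-th approximation and level `0` of the `K`-th have the same number of sites per direction
(private: same shape as the landed `BalabanUVNodes.N16AveragingPin.sitesPerDir_succ_one` over `T4Family` — gate dedup). -/
private theorem sitesPerDir_succ (K : ℕ) : (F.P (K + 1)).sitesPerDir 1 = (F.P K).sitesPerDir 0 := by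
  show 2 * F.L ^ (F.m + (K + 1) - 1) = 2 * F.L ^ (F.m + K - 0)
  congr 1

/-- A site of the `K`-th finest lattice read as a level-`1` site of the `(K+1)`-th approximation. -/
def siteDown (K : ℕ) (x : Fin 3 → ZMod ((F.P K).sitesPerDir 0)) : Site (F.P (K + 1)) 1 :=
  fun i => (ZMod.ringEquivCongr (sitesPerDir_succ F K)).symm (x i)

/-- `stepDown`: ONE Bałaban block-averaging step applied to a step-`(K+1)` configuration, read as a step-`K` configuration
(the swap map of the Lindeberg scheme). -/
noncomputable def stepDown (K : ℕ) (c : GaugeConfig 3 ((F.P (K + 1)).sitesPerDir 0) G2) :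
    GaugeConfig 3 ((F.P K).sitesPerDir 0) G2 :=
  fun e => (BlockAveraging.blockAvg (P := F.P (K + 1)) (j := 0) avSU).avg (toField F (K + 1) c) ⟨siteDown F K e.1, e.2⟩

/-! ## The nodes of the line -/

/-- NODE (SHARED verbatim with line `blocknoise_coupling`): UNIQUENESS IN LAW OF THE CESÀRO VALUE. -/
def CesaroLawUnique : Prop :=
  ∀ (F : T3ContinuumYM3Torus.T3Family) (γ : ℝ), 0 < γ → ∀ (K : ℕ) (os : List (T3ContinuumYM3Torus.ULoop3 F)) (T : ℝ)
    (Ω₁ : Type) (_ : MeasurableSpace Ω₁) (P₁ : Measure Ω₁) (_ : IsProbabilityMeasure P₁)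
    (W₁ : ℝ≥0 → Ω₁ → (Edge 3 ((F.P K).sitesPerDir 0) × NoiseIdx 2 → ℝ)) (hW₁ : IsFlatBrownian W₁ P₁)
    (U₁ : ℝ≥0 → Ω₁ → GaugeConfig 3 ((F.P K).sitesPerDir 0) G2), IsColdStartSol F γ K P₁ W₁ hW₁ U₁ →
    ∀ (Ω₂ : Type) (_ : MeasurableSpace Ω₂) (P₂ : Measure Ω₂) (_ : IsProbabilityMeasure P₂)
      (W₂ : ℝ≥0 → Ω₂ → (Edge 3 ((F.P K).sitesPerDir 0) × NoiseIdx 2 → ℝ)) (hW₂ : IsFlatBrownian W₂ P₂)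
      (U₂ : ℝ≥0 → Ω₂ → GaugeConfig 3 ((F.P K).sitesPerDir 0) G2), IsColdStartSol F γ K P₂ W₂ hW₂ U₂ →
      cesaro F K os T P₁ U₁ = cesaro F K os T P₂ U₂

/-- NODE: SCHEME-TRANSPORT COMPATIBILITY OF BAŁABAN'S ITERATED AVERAGES (bookkeeping over `Averaging.iter`, `ULoop3.atLevel`
and the `ZMod` site identifications): the step-`(K+1)` unit loop string equals the step-`K` unit loop string of the one-step
average, and the cold configuration averages to the cold configuration. -/
def StepDownCompat : Prop :=
  ∀ (F : T3ContinuumYM3Torus.T3Family) (K : ℕ),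
    (∀ (os : List (T3ContinuumYM3Torus.ULoop3 F)) (c : GaugeConfig 3 ((F.P (K + 1)).sitesPerDir 0) G2),
        obsK F (K + 1) os c = obsK F K os (stepDown F K c)) ∧
      stepDown F K (fun _ => 1) = fun _ => 1

/-- NODE: THE UNIT LOOP STRING IS IN THE CLASS — measurable, bounded by `1` (`abs_avgObs_le_one`) and `A_os`-Lipschitz for the
depth-`K` (unit) discrepancy modulo unit gauge (`loopAt_gaugeAct_walk`; trace of a product of `|C|` SU(2) matrices is
`4|C|`-Lipschitz in the entries), hence for `wdisc ≥ discG_K`. -/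
def LoopStringLipschitz : Prop :=
  ∀ (F : T3ContinuumYM3Torus.T3Family) (os : List (T3ContinuumYM3Torus.ULoop3 F)),
    ∃ A : ℝ, 0 ≤ A ∧ ∀ K : ℕ, InCls F K A (obsK F K os)

/-- NODE (stability half): THE COARSE FLOW PROPAGATES THE SCALE-WEIGHTED CLASS, UNIFORMLY IN THE CUT-OFF.  For physical
times `s ≤ T`, the transition operator `P_s g = markovTransition V P (s/ε_K) g` (the tree's Markov-semigroup vocabulary of
`WilsonMeasureLangevinInvariant`) lies in `𝒢_K(C_T · A)` whenever `g ∈ 𝒢_K(A)` — perturbing the datum at physical scale `ℓ`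
(modulo gauge) moves the law at scale `ℓ'` by at most `C_T (ℓ/ℓ')`-weighted amounts: no `K`-dependent amplification of
cut-off-scale perturbations into unit-scale statistics over a fixed physical time (weak coupling, `d = 3`; NOT a mixing
statement). -/
def ScalePropagation : Prop :=
  ∀ (F : T3ContinuumYM3Torus.T3Family) (γ : ℝ), 0 < γ → ∀ (T : ℝ), 0 < T →
    ∃ C : ℝ, 0 < C ∧ ∀ (K : ℕ) (A : ℝ) (g : GaugeConfig 3 ((F.P K).sitesPerDir 0) G2 → ℝ), InCls F K A g →
      ∀ (Ω : Type) (_ : MeasurableSpace Ω) (P : Measure Ω) (_ : IsProbabilityMeasure P)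
        (W : ℝ≥0 → Ω → (Edge 3 ((F.P K).sitesPerDir 0) × NoiseIdx 2 → ℝ)) (hW : IsFlatBrownian W P)
        (V : GaugeConfig 3 ((F.P K).sitesPerDir 0) G2 → ℝ≥0 → Ω → GaugeConfig 3 ((F.P K).sitesPerDir 0) G2),
        IsSolFamily F γ K P W hW V →
        ∀ s : ℝ, 0 ≤ s → s ≤ T →
          InCls F K (C * A) (markovTransition V P (s / (F.P K).eps).toNNReal g)

/-- LOAD-BEARING NODE (consistency half): THE ONE-WINDOW WEAK COMMUTATOR ALONG THE FINE COLD-START FLOW, GEOMETRIC IN THE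
CUT-OFF.  For windows of physical length `τ ≤ τ₀` starting at any `t₀ ≤ T`: «evolve the fine (step `K+1`) cold-start process
for `τ`, then apply one averaging step» and «apply the averaging step at `t₀`, then evolve with the coarse (step `K`) flow
for `τ`» have laws that differ by at most `C · A · r^K` against every `g ∈ 𝒢_K(A)` (expectation over the fine process at
`t₀` of the coarse Markov expectation).  The dynamic form of ONE renormalisation step of a superrenormalisable theory; the
large-field events along the cold-start flow in finite volume are part of its burden. -/
def OneWindowSwap : Prop :=
  ∀ (F : T3ContinuumYM3Torus.T3Family) (γ : ℝ), 0 < γ → ∀ (T : ℝ), 0 < T →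
    ∃ C r τ₀ : ℝ, 0 < C ∧ 0 < r ∧ r < 1 ∧ 0 < τ₀ ∧
      ∀ (K : ℕ) (Ω : Type) (_ : MeasurableSpace Ω) (P : Measure Ω) (_ : IsProbabilityMeasure P)
        (W' : ℝ≥0 → Ω → (Edge 3 ((F.P (K + 1)).sitesPerDir 0) × NoiseIdx 2 → ℝ)) (hW' : IsFlatBrownian W' P)
        (U' : ℝ≥0 → Ω → GaugeConfig 3 ((F.P (K + 1)).sitesPerDir 0) G2), IsColdStartSol F γ (K + 1) P W' hW' U' →
        ∀ (Ω₂ : Type) (_ : MeasurableSpace Ω₂) (P₂ : Measure Ω₂) (_ : IsProbabilityMeasure P₂)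
          (W₂ : ℝ≥0 → Ω₂ → (Edge 3 ((F.P K).sitesPerDir 0) × NoiseIdx 2 → ℝ)) (hW₂ : IsFlatBrownian W₂ P₂)
          (V : GaugeConfig 3 ((F.P K).sitesPerDir 0) G2 → ℝ≥0 → Ω₂ → GaugeConfig 3 ((F.P K).sitesPerDir 0) G2),
          IsSolFamily F γ K P₂ W₂ hW₂ V →
          ∀ (A : ℝ) (g : GaugeConfig 3 ((F.P K).sitesPerDir 0) G2 → ℝ), InCls F K A g →
            ∀ t₀ τ : ℝ, 0 ≤ t₀ → 0 ≤ τ → τ ≤ τ₀ → t₀ + τ ≤ T →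
              |(∫ ω, g (stepDown F K (U' ((t₀ + τ) / (F.P (K + 1)).eps).toNNReal ω)) ∂P) -
                  ∫ ω, markovTransition V P₂ (τ / (F.P K).eps).toNNReal g (stepDown F K (U' (t₀ / (F.P (K + 1)).eps).toNNReal ω)) ∂P|
                ≤ C * A * r ^ K

/-- OUTPUT SHAPE OF THE TELESCOPING: consecutive cut-offs' Cesàro values, computed in ANY cold-start solutions on ANY spaces,
differ by `C r^K`. -/
def GeomIncrements : Prop :=
  ∀ (F : T3ContinuumYM3Torus.T3Family) (γ : ℝ), 0 < γ → ∀ (os : List (T3ContinuumYM3Torus.ULoop3 F)) (T : ℝ), 0 < T →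
    ∃ C r : ℝ, 0 < r ∧ r < 1 ∧ ∀ (K : ℕ)
      (Ω' : Type) (_ : MeasurableSpace Ω') (P' : Measure Ω') (_ : IsProbabilityMeasure P')
      (W' : ℝ≥0 → Ω' → (Edge 3 ((F.P (K + 1)).sitesPerDir 0) × NoiseIdx 2 → ℝ)) (hW' : IsFlatBrownian W' P')
      (U' : ℝ≥0 → Ω' → GaugeConfig 3 ((F.P (K + 1)).sitesPerDir 0) G2), IsColdStartSol F γ (K + 1) P' W' hW' U' →
      ∀ (Ω : Type) (_ : MeasurableSpace Ω) (P : Measure Ω) (_ : IsProbabilityMeasure P)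
        (W : ℝ≥0 → Ω → (Edge 3 ((F.P K).sitesPerDir 0) × NoiseIdx 2 → ℝ)) (hW : IsFlatBrownian W P)
        (U : ℝ≥0 → Ω → GaugeConfig 3 ((F.P K).sitesPerDir 0) G2), IsColdStartSol F γ K P W hW U →
        |cesaro F (K + 1) os T P' U' - cesaro F K os T P U| ≤ C * r ^ K

/-- NODE (the Lindeberg bookkeeping, classical but not small): law uniqueness + transport compatibility + one-window swap +
class propagation + loop string in the class ⇒ geometric increments.  Inside: existence of jointly measurable coarse
solution families (SZZ Lemma 3.2 + measurable dependence on the datum), the Markov property of both dynamics at the window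
boundaries `j τ₀`, the hybrids `Z_j`, Fubini, and `⌈T/τ₀⌉ + 1` windows. -/
def LindebergTelescoping : Prop :=
  CesaroLawUnique → StepDownCompat → OneWindowSwap → ScalePropagation → LoopStringLipschitz → GeomIncrements

/-- RUNG NODE (weak first rung, fixed cut-off, classical; not in the composition chain): at ONE step `K` the one-window swap
error against any `g ∈ 𝒢_K(A)` is `≤ A δ` for windows `τ ≤ τ₀(K, δ)` (a.s. path continuity of both solutions + dominated
convergence; at `τ = 0` both sides agree).  Exercises the swap functional and the class in a decided regime. -/
def ShortWindowSwap : Prop :=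
  ∀ (F : T3ContinuumYM3Torus.T3Family) (γ : ℝ), 0 < γ → ∀ (T : ℝ), 0 < T → ∀ (K : ℕ) (δ : ℝ), 0 < δ →
    ∃ τ₀ : ℝ, 0 < τ₀ ∧
      ∀ (Ω : Type) (_ : MeasurableSpace Ω) (P : Measure Ω) (_ : IsProbabilityMeasure P)
        (W' : ℝ≥0 → Ω → (Edge 3 ((F.P (K + 1)).sitesPerDir 0) × NoiseIdx 2 → ℝ)) (hW' : IsFlatBrownian W' P)
        (U' : ℝ≥0 → Ω → GaugeConfig 3 ((F.P (K + 1)).sitesPerDir 0) G2), IsColdStartSol F γ (K + 1) P W' hW' U' →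
        ∀ (Ω₂ : Type) (_ : MeasurableSpace Ω₂) (P₂ : Measure Ω₂) (_ : IsProbabilityMeasure P₂)
          (W₂ : ℝ≥0 → Ω₂ → (Edge 3 ((F.P K).sitesPerDir 0) × NoiseIdx 2 → ℝ)) (hW₂ : IsFlatBrownian W₂ P₂)
          (V : GaugeConfig 3 ((F.P K).sitesPerDir 0) G2 → ℝ≥0 → Ω₂ → GaugeConfig 3 ((F.P K).sitesPerDir 0) G2),
          IsSolFamily F γ K P₂ W₂ hW₂ V →
          ∀ (A : ℝ) (g : GaugeConfig 3 ((F.P K).sitesPerDir 0) G2 → ℝ), InCls F K A g →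
            ∀ t₀ τ : ℝ, 0 ≤ t₀ → 0 ≤ τ → τ ≤ τ₀ → t₀ + τ ≤ T →
              |(∫ ω, g (stepDown F K (U' ((t₀ + τ) / (F.P (K + 1)).eps).toNNReal ω)) ∂P) -
                  ∫ ω, markovTransition V P₂ (τ / (F.P K).eps).toNNReal g (stepDown F K (U' (t₀ / (F.P (K + 1)).eps).toNNReal ω)) ∂P|
                ≤ A * δ

/-! ## Registered stub signatures (convention of this seat: `__Registered` aliases; `_of` hypotheses by these names) -/

namespace __Registered

/-- M/L — shared with line `blocknoise_coupling`. -/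
abbrev stub_cesaroLawUnique : Prop := CesaroLawUnique
/-- M — scheme transport of iterated averages; `stepDown 1 = 1`. -/
abbrev stub_stepDownCompat : Prop := StepDownCompat
/-- XL — LOAD-BEARING: one-window weak commutator, geometric in `K`. -/
abbrev stub_oneWindowSwap : Prop := OneWindowSwap
/-- XL/L — K-uniform multiscale stability of the coarse flow over physical time `T`. -/
abbrev stub_scalePropagation : Prop := ScalePropagation
/-- M — the loop string is in the class. -/
abbrev stub_loopStringLipschitz : Prop := LoopStringLipschitz
/-- L — the Lindeberg telescoping bookkeeping. -/
abbrev stub_lindebergTelescoping : Prop := LindebergTelescoping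
/-- rung (weak, fixed `K`). -/
abbrev stub_shortWindowSwap : Prop := ShortWindowSwap

end __Registered

/-! ## The two free stubs, by name -/

/-- Registered stub `stub_cesaroLawUnique` of LINE 3 (statement verbatim), closed by the landed `cesaroLawUnique` (p625805). -/
theorem stub_cesaroLawUnique : __Registered.stub_cesaroLawUnique :=
  Summit.QuantumFields.YangMills.Theorems.ColdStartUniversality.cesaroLawUnique

/-- Registered stub `stub_loopStringLipschitz` of LINE 3 (statement verbatim), closed by the landed proof of item 26919. -/
theorem stub_loopStringLipschitz : __Registered.stub_loopStringLipschitz :=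
  Summit.QuantumFields.YangMills.Theorems.TransportPerturbation.loopStringLipschitz_proof

end Summit.QuantumFields.YangMills.Cruxes.ColdStartContinuumCauchy.LindebergSwap
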